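import Summits.ResolutionOfSingularities.ResolutionOfSingularities.Theses.MaxContactCut
import Summits.ResolutionOfSingularities.ResolutionOfSingularities.Theorems.ContactShadowClasses
import Summits.ResolutionOfSingularities.ResolutionOfSingularities.Theorems.ContactShadowKernels
import Summits.ResolutionOfSingularities.ResolutionOfSingularities.Theorems.MaxContactCutMonomialTowers
import Summits.ResolutionOfSingularities.ResolutionOfSingularities.Theorems.MaxContactCutExhaustion
import Summits.ResolutionOfSingularities.ResolutionOfSingularities.Theorems.MaxContactCutTauLadder

/-!
# MaxContactCutContactShadow — the g12 node «ContactShadow» wired to the route MaxContactCut BY NAME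
(decomp-res node N59, lens-4 g12 sha256 1ef413f33f2c62b4; CRITIC-LEDGER line 97 CLEARED; phase 3 of 3)

Vocabulary, pieces, ports and the paper proofs: `Theorems/ContactShadowClasses`; proved kernels:
`Theorems/ContactShadowKernels`.  Route asides (MaxContactCut, `aside · rank 9`, refining the contact leaf
`NoContactHuggingTowers` 31571): the two COLUMNS `CSNoContactHuggingTowersPerfect` [perfect ground field ·
DECIDED-MOD-PORT: ports `CSContactShadowAll` + `CSTowerObstructsAll` + the tree's X1 `MarkedThreefoldResolution` 28616 BY
NAME, `c := n!`] and `CSNoContactHuggingTowersImperfect` [LOCATED via `CSFormalContactShadowAll` in the dim-3 LOCAL shadow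
class `𝔖(n!)`, whose transversal / curve / order-one pieces are decided modulo `CSCornerNormalFormShAll`, `CSCornerModelGE`
(or the direct combinatorial leaf `CSNoCornerTowerGEAll`), `CSCurveLawShAll`, `CSSurfaceLawShAll`], and THE LOCATED RESIDUAL
`CSNoWildShadowTowersImp` [imperfect residue field, singular-surface hugging; IDEA-NEEDED].

Kernels (all by name, 0 sorry; the aside-level `Iff.rfl` unfoldings and re-keyings are the companion file
`MaxContactCutContactShadowAsides`, filed once the asides exist on the route): 31571 ⟺ its two columns EXACTLY
(`noContactHuggingTowers_iff_columns`, `noContactHuggingTowers_iff_asides`); necessity port-free (`contactPerfect_of_item`,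
`contactImperfect_of_item`, `csPerfect_of_item`, `csImperfect_of_item`); the perfect column from the ports and X1
(`contactPerfect_of_ports`, `csPerfect_of_portAsides`); the imperfect column from the ports and the residual
(`csImperfect_of_portAsides`, `csImperfect_of_leafAsides`); 31571 from everything (`noContactHuggingTowers_of_g12`,
`noContactHuggingTowers_of_asides`, `noContactHuggingTowers_of_shadow`); the up-links to 31570 / 30253 / the located core
28544: `noHuggingTowers_of_g12` here, and the TREE kernels `MaxContactCutMonomialTowers.noForcedTowers_of_leaves` /
`MaxContactCutMonomialTowers.core_of_leaves` verbatim (not restated: dedup).  ROOT BY NAME is the route's `closes`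
(not restated).  WHY THIS IS NOVEL (critic row 76): the recorded
attack plan of 31571 («the dim-3 shadow on the hugged regular hypersurface») is carried out by transferring the CLOSURE
CLASS of the weighted coefficient ideal along the Bravo–Villamayor étale retraction onto the hugged germ; HUGGING +
ISOLATION (forcedness), not maximal contact, make its top locus exactly the point at every stage, so that pure EXISTENCE
statements one dimension down (X1; centre counting) decide the perfect column.  (Sources: BravoVillamayor2011 Appendix
(32); Kollar2007 (3.54.1), Thm 3.69; HunekeSwanson2006 Thm 6.8.3; Matsumura1987 Thms 23.7, 15.1, 8.14; CossartJannsenSaito2020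
Thm 6.35 / 6.40.)
-/

namespace Summit.ResolutionOfSingularities.ResolutionOfSingularities.Theorems.MaxContactCutContactShadow

open CategoryTheory AlgebraicGeometry
open Literature.AlgebraicGeometry.Resolution
open Summit.ResolutionOfSingularities.ResolutionOfSingularities.Theses
open Summit.ResolutionOfSingularities.ResolutionOfSingularities.Theorems
open WeakOrderReduction ForcedTowerClasses DivergentTowerClasses MonomialTowerClasses
open HugDimensionClasses HugDimensionKernels ContactShadowClasses ContactShadowKernels

/-! ## The perfect column (lens §5) -/

/-- **THE PERFECT COLUMN OF 31571 IS DECIDED modulo `ContactShadow`, `TowerObstructsAll` and the tree's X1 (28616)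
BY NAME** (`c := n!`; packaging via the landed `weakResolution_of_resolution` / `weakResolution_iff`). [folklore] -/
theorem contactPerfect_of_ports {n : ℕ} (hS : ContactShadow n) (hO : TowerObstructsAll)
    (hX : MaxContactCut.MarkedThreefoldResolution) : ContactPerfect n := by
  intro p hp k _ _ _ T g hB hD hE hC
  obtain ⟨T', g', hB', hdim, hE', hμ, hfin⟩ := hS p hp k T g hB hD hE hC
  have key : ∀ M : MarkedIdeal (T'.St 0), M.boundary = [] → M.mult = n.factorial →
      (∀ y : T'.St 0, idealOrder M.ideal y ≠ ⊤) → ∃ t : CentreSeq (T'.St 0), WeakResolution t M := by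
    rintro ⟨I, E, r⟩ hEM hrM hIM
    dsimp only at hEM hrM hIM
    subst hEM hrM
    obtain ⟨t, ht⟩ := hX n.factorial (Nat.succ_le_of_lt n.factorial_pos) p hp k (T'.St 0) g' hB'.isSeparated
      hB'.locallyOfFiniteType hB'.quasiCompact hB'.isRegular hdim I hIM
    exact ⟨t, (MaxContactCutTauLadder.weakResolution_iff t _).mpr
      (MaxContactCutExhaustion.weakResolution_of_resolution t _ ht)⟩
  exact hO p hp k T' g' hB' (key (T'.D 0) hE' hμ hfin)

/-- The perfect column is implied by 31571 (WEAKER by letter). [folklore] -/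
theorem contactPerfect_of_item (h : MaxContactCut.NoContactHuggingTowers) : ∀ n : ℕ, 1 ≤ n → ContactPerfect n :=
  fun n hn => noTowerPerfect_of_noTower (h n hn)

/-! ## The imperfect column and 31571 (lens §5 «Assembly», §6) -/

/-- The imperfect column is implied by 31571 (WEAKER by letter). [folklore] -/
theorem contactImperfect_of_item (h : MaxContactCut.NoContactHuggingTowers) :
    ∀ n : ℕ, 1 ≤ n → ContactImperfect n :=
  fun n hn => noTowerImperfect_of_noTower (h n hn)

/-- **31571 `NoContactHuggingTowers` FROM THE g12 PIECES**: the perfect column decided (ports + X1), the imperfect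
column reduced to the located residual `ShadowWildImp n!`. [folklore] -/
theorem noContactHuggingTowers_of_g12 (hS : ∀ n : ℕ, 1 ≤ n → ContactShadow n) (hO : TowerObstructsAll)
    (hX : MaxContactCut.MarkedThreefoldResolution) (hF : ∀ n : ℕ, 1 ≤ n → FormalContactShadow n)
    (hCN : ∀ N : ℕ, 1 ≤ N → CornerNormalFormSh N) (hCM : CornerModelGE) (hCL : ∀ N : ℕ, 1 ≤ N → CurveLawSh N)
    (hSL : ∀ N : ℕ, 1 ≤ N → SurfaceLawSh N) (hW : ∀ n : ℕ, 1 ≤ n → ShadowWildImp n.factorial) :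
    MaxContactCut.NoContactHuggingTowers := by
  intro n hn
  have hN : 1 ≤ n.factorial := Nat.succ_le_of_lt n.factorial_pos
  exact contact_iff_columns.mpr ⟨contactPerfect_of_ports (hS n hn) hO hX,
    contactImperfect_of_ports (hF n hn) (hCN _ hN) hCM hO (hCL _ hN) (hSL _ hN) (hW n hn)⟩

/-- ALL fields, without X1: 31571 from the formal shadow and the WHOLE shadow class (`ShadowWild n!` undecided in
every column — recorded for the map, not used in the score). [folklore] -/
theorem noContactHuggingTowers_of_shadow (hF : ∀ n : ℕ, 1 ≤ n → FormalContactShadow n)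
    (hCN : ∀ N : ℕ, 1 ≤ N → CornerNormalFormSh N) (hCM : CornerModelGE) (hO : TowerObstructsAll)
    (hCL : ∀ N : ℕ, 1 ≤ N → CurveLawSh N) (hSL : ∀ N : ℕ, 1 ≤ N → SurfaceLawSh N)
    (hW : ∀ N : ℕ, 1 ≤ N → ShadowWild N) : MaxContactCut.NoContactHuggingTowers := by
  intro n hn
  have hN : 1 ≤ n.factorial := Nat.succ_le_of_lt n.factorial_pos
  exact contact_of_formal (hF n hn) (shadow_of_pieces (shadowTransversal_of_model hN (hCN _ hN) hCM hO)
    (shadowCurve_of_law (hCL _ hN)) (shadowContact_of_law (hSL _ hN)) (hW _ hN))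

/-- **31570 `NoHuggingTowers` BY NAME** from 31571 (this node) and the tree's wild leaf 31572. [folklore] -/
theorem noHuggingTowers_of_g12 (h₁ : MaxContactCut.NoContactHuggingTowers) (h₂ : MaxContactCut.NoWildHuggingTowers) :
    MaxContactCut.NoHuggingTowers :=
  MaxContactCutMonomialTowers.noHuggingTowers_iff_contact_wild.mpr ⟨h₁, h₂⟩

/-- **EXACT**: 31571 ⟺ its two columns (all markings). [folklore] -/
theorem noContactHuggingTowers_iff_columns :
    MaxContactCut.NoContactHuggingTowers ↔ NoContactHuggingTowersPerfect ∧ NoContactHuggingTowersImperfect :=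
  ⟨fun h => ⟨contactPerfect_of_item h, contactImperfect_of_item h⟩,
    fun h n hn => contact_iff_columns.mpr ⟨h.1 n hn, h.2 n hn⟩⟩

/-- The perfect column, all markings, from the ports and X1. [folklore] -/
theorem noContactHuggingTowersPerfect_of_ports (hS : ∀ n : ℕ, 1 ≤ n → ContactShadow n) (hO : TowerObstructsAll)
    (hX : MaxContactCut.MarkedThreefoldResolution) : NoContactHuggingTowersPerfect :=
  fun n hn => contactPerfect_of_ports (hS n hn) hO hX
end Summit.ResolutionOfSingularities.ResolutionOfSingularities.Theorems.MaxContactCutContactShadow
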